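import Summits.Ventures.LatticeQCDFlow.Scoring.NonabelianAreaLaw2DWilsonLoop
import HarnessLib

/-!
# The exact non-abelian area law in two dimensions, IV-a: strip absorption and the bookkeeping of private links

HONEST FRAMING: exact (Metropolis-corrected) sampling algorithms for lattice gauge theory;
figures of merit are autocorrelation/cost numbers at stated couplings and volumes; no
continuum-physics claim.

Venture `LatticeQCDFlow` (cell pub-lqcd), sub-topic `Scoring`; FANOUT row 5 (`s0-sun-a`), GEN-18.
NEW WORK of the cell (placement rule).  Parts II/III (`NonabelianAreaLaw2DWilsonLoop`, `…OpenWilsonLoop`) give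
the free-boundary area law when the weighted region is the loop's own interior; parts IV-a/b/c move the loop
ANYWHERE inside an open `R₀ × T₀` lattice by peeling the outer plaquettes strip by strip, for every compact
second-countable gauge group `G` and every continuous weight `w` (no class property is needed to peel).
This file holds the two reusable tools:

* §1 **`integral_prod_words_mul`**, **`integral_prod_invWords_mul`** — STRIP ABSORPTION (the scalar form of
  part I's column absorption): for words `A_c · U_{e_c}^{±1} · B_c`, `c < T`, in DISTINCT private links `e_c`
  with continuous coefficients `A_c, B_c` and a continuous factor `Ψ` all ignoring every private link,
  `∫ (∏_{c<T} w(A_c U_{e_c}^{±1} B_c)) · Ψ dHaar^{⊗E} = (∫ w dHaar)^T · ∫ Ψ dHaar^{⊗E}` (induction on `T`,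
  one-link peeling of part I);
* §2 bookkeeping on `(ℤ/L)²` in the coordinates `(i + a, j + b)`: a horizontal line / the `R × T` loop ignore
  the horizontal links of other rows (`lineHolonomy_zero_update_of_snd_ne`, `rectangleHolonomy_update_row`;
  the column versions are in part II); the plaquettes of a rectangle ignore the vertical links of the column to
  its LEFT and the horizontal links of the rows just ABOVE / BELOW it
  (`plaquetteHolonomy_update_leftcol/toprow/bottomrow_of_mem_rect`; the right column is part II's
  `plaquetteHolonomy_update_col_of_mem_rect`); splitting a product over a rectangle off its first column /
  top row / bottom row (`prod_rect_succ_left/top/bottom`; the last column is part II's `prod_rect_succ_eq`).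

No `def`, nothing cited as a fact, 0 sorry.
-/

noncomputable section

open MeasureTheory Function Finset
open Literature.MathematicalPhysics.QuantumFieldTheory
open Literature.MathematicalPhysics.QuantumLattice
open Summit.Ventures.LatticeQCDFlow.Theory2.Lattice
open Summit.Ventures.LatticeQCDFlow.Theory2.Lattice.TwoDim

namespace Summit.Ventures.LatticeQCDFlow.Scoring

variable {L : ℕ} [NeZero L] {G : Type*} [Group G] [TopologicalSpace G] [IsTopologicalGroup G]
  [CompactSpace G] [SecondCountableTopology G] [MeasurableSpace G] [BorelSpace G]

/-! ## §1. Strip absorption (scalar) -/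

/-- **Strip absorption.**  For words `A_c · U_{e_c} · B_c`, `c < T`, in distinct private links, with
continuous coefficients and a continuous factor `Ψ` that ignore every private link:
`∫ (∏_{c<T} w(A_c U_{e_c} B_c)) · Ψ dHaar^{⊗E} = (∫ w dHaar)^T · ∫ Ψ dHaar^{⊗E}`. -/
theorem integral_prod_words_mul {w : G → ℝ} (hw : Continuous w) :
    ∀ (T : ℕ) (e : ℕ → Edge 2 L) (A B : ℕ → GaugeConfig 2 L G → G) (Ψ : GaugeConfig 2 L G → ℂ),
      (∀ c < T, ∀ c' < T, e c = e c' → c = c') →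
      (∀ c, Continuous (A c)) → (∀ c, Continuous (B c)) →
      (∀ c c' U g, A c (update U (e c') g) = A c U) →
      (∀ c c' U g, B c (update U (e c') g) = B c U) →
      Continuous Ψ → (∀ c U g, Ψ (update U (e c) g) = Ψ U) →
        ∫ U, (∏ c ∈ range T, (w (A c U * U (e c) * B c U) : ℂ)) * Ψ U
            ∂(Measure.pi fun _ : Edge 2 L => haarProbability G) =
          (∫ g, (w g : ℂ) ∂(haarProbability G)) ^ T *
            ∫ U, Ψ U ∂(Measure.pi fun _ : Edge 2 L => haarProbability G) := by
  intro T
  induction T with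
  | zero =>
    intro e A B Ψ _ _ _ _ _ _ _
    simp
  | succ T ih =>
    intro e A B Ψ he hA hB hAe hBe hΨ hΨe
    have he' : ∀ c < T, ∀ c' < T, e (c + 1) = e (c' + 1) → c = c' := fun c hc c' hc' h =>
      Nat.succ_injective (he (c + 1) (by omega) (c' + 1) (by omega) h)
    have hne : ∀ c < T, e (c + 1) ≠ e 0 := fun c hc h =>
      absurd (he (c + 1) (by omega) 0 (by omega) h) (Nat.succ_ne_zero c)
    have hwords : ∀ c, Continuous fun U : GaugeConfig 2 L G => A c U * U (e c) * B c U :=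
      fun c => ((hA c).mul (continuous_apply (e c))).mul (hB c)
    let Φ : GaugeConfig 2 L G → ℂ := fun U =>
      (∏ c ∈ range T, (w (A (c + 1) U * U (e (c + 1)) * B (c + 1) U) : ℂ)) * Ψ U
    have hΦc : Continuous Φ :=
      (continuous_finsetProd _ fun c _ => Complex.continuous_ofReal.comp (hw.comp (hwords (c + 1)))).mul hΨ
    have hΦe : ∀ U g, Φ (update U (e 0) g) = Φ U := by
      intro U g
      have hprod : (∏ c ∈ range T,
            (w (A (c + 1) (update U (e 0) g) * update U (e 0) g (e (c + 1)) * B (c + 1) (update U (e 0) g)) : ℂ)) =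
          ∏ c ∈ range T, (w (A (c + 1) U * U (e (c + 1)) * B (c + 1) U) : ℂ) := by
        refine Finset.prod_congr rfl fun c hc => ?_
        rw [Finset.mem_range] at hc
        rw [hAe, hBe, update_of_ne (hne c hc)]
      simp only [Φ, hprod, hΨe]
    have hpt : ∀ U : GaugeConfig 2 L G,
        (∏ c ∈ range (T + 1), (w (A c U * U (e c) * B c U) : ℂ)) * Ψ U =
          (w (A 0 U * U (e 0) * B 0 U) : ℂ) * Φ U := by
      intro U
      rw [Finset.prod_range_succ' (fun c => (w (A c U * U (e c) * B c U) : ℂ)) T]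
      simp only [Φ]
      ring
    simp_rw [hpt]
    have h := integral_comp_link_mul_eq (e 0) hΦc hΦe (hA 0) (hB 0) (hAe 0 0) (hBe 0 0)
      (f := fun g => (w g : ℂ)) (Complex.continuous_ofReal.comp hw)
    simp only at h
    rw [h, ih (fun c => e (c + 1)) (fun c => A (c + 1)) (fun c => B (c + 1)) Ψ he'
      (fun c => hA (c + 1)) (fun c => hB (c + 1)) (fun c c' => hAe (c + 1) (c' + 1))
      (fun c c' => hBe (c + 1) (c' + 1)) hΨ (fun c => hΨe (c + 1)), pow_succ']
    ring

/-- Strip absorption with the private links inverted: words `A_c · U_{e_c}⁻¹ · B_c`. -/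
theorem integral_prod_invWords_mul {w : G → ℝ} (hw : Continuous w) :
    ∀ (T : ℕ) (e : ℕ → Edge 2 L) (A B : ℕ → GaugeConfig 2 L G → G) (Ψ : GaugeConfig 2 L G → ℂ),
      (∀ c < T, ∀ c' < T, e c = e c' → c = c') →
      (∀ c, Continuous (A c)) → (∀ c, Continuous (B c)) →
      (∀ c c' U g, A c (update U (e c') g) = A c U) →
      (∀ c c' U g, B c (update U (e c') g) = B c U) →
      Continuous Ψ → (∀ c U g, Ψ (update U (e c) g) = Ψ U) →
        ∫ U, (∏ c ∈ range T, (w (A c U * (U (e c))⁻¹ * B c U) : ℂ)) * Ψ U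
            ∂(Measure.pi fun _ : Edge 2 L => haarProbability G) =
          (∫ g, (w g : ℂ) ∂(haarProbability G)) ^ T *
            ∫ U, Ψ U ∂(Measure.pi fun _ : Edge 2 L => haarProbability G) := by
  intro T
  induction T with
  | zero =>
    intro e A B Ψ _ _ _ _ _ _ _
    simp
  | succ T ih =>
    intro e A B Ψ he hA hB hAe hBe hΨ hΨe
    have he' : ∀ c < T, ∀ c' < T, e (c + 1) = e (c' + 1) → c = c' := fun c hc c' hc' h =>
      Nat.succ_injective (he (c + 1) (by omega) (c' + 1) (by omega) h)
    have hne : ∀ c < T, e (c + 1) ≠ e 0 := fun c hc h =>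
      absurd (he (c + 1) (by omega) 0 (by omega) h) (Nat.succ_ne_zero c)
    have hwords : ∀ c, Continuous fun U : GaugeConfig 2 L G => A c U * (U (e c))⁻¹ * B c U :=
      fun c => ((hA c).mul (continuous_apply (e c)).inv).mul (hB c)
    let Φ : GaugeConfig 2 L G → ℂ := fun U =>
      (∏ c ∈ range T, (w (A (c + 1) U * (U (e (c + 1)))⁻¹ * B (c + 1) U) : ℂ)) * Ψ U
    have hΦc : Continuous Φ :=
      (continuous_finsetProd _ fun c _ => Complex.continuous_ofReal.comp (hw.comp (hwords (c + 1)))).mul hΨ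
    have hΦe : ∀ U g, Φ (update U (e 0) g) = Φ U := by
      intro U g
      have hprod : (∏ c ∈ range T,
            (w (A (c + 1) (update U (e 0) g) * (update U (e 0) g (e (c + 1)))⁻¹ *
              B (c + 1) (update U (e 0) g)) : ℂ)) =
          ∏ c ∈ range T, (w (A (c + 1) U * (U (e (c + 1)))⁻¹ * B (c + 1) U) : ℂ) := by
        refine Finset.prod_congr rfl fun c hc => ?_
        rw [Finset.mem_range] at hc
        rw [hAe, hBe, update_of_ne (hne c hc)]
      simp only [Φ, hprod, hΨe]
    have hpt : ∀ U : GaugeConfig 2 L G,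
        (∏ c ∈ range (T + 1), (w (A c U * (U (e c))⁻¹ * B c U) : ℂ)) * Ψ U =
          (w (A 0 U * (U (e 0))⁻¹ * B 0 U) : ℂ) * Φ U := by
      intro U
      rw [Finset.prod_range_succ' (fun c => (w (A c U * (U (e c))⁻¹ * B c U) : ℂ)) T]
      simp only [Φ]
      ring
    simp_rw [hpt]
    have h := integral_comp_link_inv_mul_eq (e 0) hΦc hΦe (hA 0) (hB 0) (hAe 0 0) (hBe 0 0)
      (f := fun g => (w g : ℂ)) (Complex.continuous_ofReal.comp hw)
    simp only at h
    rw [h, ih (fun c => e (c + 1)) (fun c => A (c + 1)) (fun c => B (c + 1)) Ψ he'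
      (fun c => hA (c + 1)) (fun c => hB (c + 1)) (fun c c' => hAe (c + 1) (c' + 1))
      (fun c c' => hBe (c + 1) (c' + 1)) hΨ (fun c => hΨe (c + 1)), pow_succ']
    ring

/-! ## §2. Bookkeeping: loops, sub-rectangles and private links -/

section Bookkeeping

omit [NeZero L] [TopologicalSpace G] [IsTopologicalGroup G] [CompactSpace G] [SecondCountableTopology G]
  [MeasurableSpace G] [BorelSpace G] in
/-- A horizontal line in row `y` ignores the horizontal links of every other row `y'`. -/
theorem lineHolonomy_zero_update_of_snd_ne {U : GaugeConfig 2 L G} {y y' : ZMod L} (hy : y ≠ y')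
    (x x' : ZMod L) (g : G) (n : ℕ) :
    lineHolonomy (update U (![x', y'], 0) g) 0 n ![x, y] = lineHolonomy U 0 n ![x, y] :=
  lineHolonomy_congr 0 n _ fun s _ => by
    rw [vec2_add_single_zero]
    exact update_of_ne (fun h => hy (vec2_eq_iff.mp (congrArg Prod.fst h)).2) _ _

omit [NeZero L] [TopologicalSpace G] [IsTopologicalGroup G] [CompactSpace G] [SecondCountableTopology G]
  [MeasurableSpace G] [BorelSpace G] in
/-- The `R × T` loop with corner `(i, j)` ignores the horizontal links of every row other than `j` and
`j + T`. -/
theorem rectangleHolonomy_update_row {U : GaugeConfig 2 L G} (i j : ZMod L) (R T : ℕ) {y' : ZMod L}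
    (h0 : j ≠ y') (hT : j + T ≠ y') (x' : ZMod L) (g : G) :
    rectangleHolonomy (update U (![x', y'], 0) g) ![i, j] 0 1 R T = rectangleHolonomy U ![i, j] 0 1 R T := by
  rw [rectangleHolonomy_vec2, rectangleHolonomy_vec2,
    lineHolonomy_update_of_snd_ne (k := 1) (k' := 0) (by decide),
    lineHolonomy_update_of_snd_ne (k := 1) (k' := 0) (by decide),
    lineHolonomy_zero_update_of_snd_ne h0, lineHolonomy_zero_update_of_snd_ne hT]

omit [NeZero L] [TopologicalSpace G] [IsTopologicalGroup G] [CompactSpace G] [SecondCountableTopology G]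
  [MeasurableSpace G] [BorelSpace G] in
/-- A plaquette of the rectangle with corner `(x + 1, j)` and width `R` (`R + 2 ≤ L`) ignores the vertical
links of the column `x`. -/
theorem plaquetteHolonomy_update_leftcol_of_mem_rect {U : GaugeConfig 2 L G} (x j : ZMod L) {R T : ℕ}
    (hR : R + 2 ≤ L) {p : Site 2 L}
    (hp : p ∈ (range R ×ˢ range T).image (fun q : ℕ × ℕ => (![x + 1 + q.1, j + q.2] : Site 2 L)))
    (y' : ZMod L) (g : G) :
    plaquetteHolonomy (update U (![x, y'], 1) g) p 0 1 = plaquetteHolonomy U p 0 1 := by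
  obtain ⟨⟨a', b'⟩, hq, rfl⟩ := Finset.mem_image.mp hp
  rw [Finset.mem_product, Finset.mem_range, Finset.mem_range] at hq
  refine plaquetteHolonomy_update_vert g (fun h => ?_) (fun h => ?_)
  · have h1 := (vec2_eq_iff.mp h).1
    rw [add_assoc] at h1
    have h2 : (1 : ZMod L) + (a' : ZMod L) = 0 := left_eq_add.mp h1.symm
    refine natCast_zmod_ne_of_lt (L := L) (j := a' + 1) (k := 0) (by omega) (by omega) (by omega) ?_
    push_cast
    linear_combination h2
  · rw [shift_vec2_zero] at h
    have h1 := (vec2_eq_iff.mp h).1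
    rw [add_assoc, add_assoc] at h1
    have h2 : (1 : ZMod L) + ((a' : ZMod L) + 1) = 0 := left_eq_add.mp h1.symm
    refine natCast_zmod_ne_of_lt (L := L) (j := a' + 2) (k := 0) (by omega) (by omega) (by omega) ?_
    push_cast
    linear_combination h2

omit [NeZero L] [TopologicalSpace G] [IsTopologicalGroup G] [CompactSpace G] [SecondCountableTopology G]
  [MeasurableSpace G] [BorelSpace G] in
/-- A plaquette of the rectangle with corner `(i, j)` and height `T` (`T + 2 ≤ L`) ignores the horizontal
links of the row `j + T + 1`. -/
theorem plaquetteHolonomy_update_toprow_of_mem_rect {U : GaugeConfig 2 L G} (i j : ZMod L) {R T : ℕ}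
    (hT : T + 2 ≤ L) {p : Site 2 L}
    (hp : p ∈ (range R ×ˢ range T).image (fun q : ℕ × ℕ => (![i + q.1, j + q.2] : Site 2 L)))
    (x' : ZMod L) (g : G) :
    plaquetteHolonomy (update U (![x', j + T + 1], 0) g) p 0 1 = plaquetteHolonomy U p 0 1 := by
  obtain ⟨⟨a', b'⟩, hq, rfl⟩ := Finset.mem_image.mp hp
  rw [Finset.mem_product, Finset.mem_range, Finset.mem_range] at hq
  refine plaquetteHolonomy_update_horiz g (fun h => ?_) (fun h => ?_)
  · have h1 := (vec2_eq_iff.mp h).2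
    rw [add_assoc] at h1
    refine natCast_zmod_ne_of_lt (L := L) (j := b') (k := T + 1) (by omega) (by omega) (by omega) ?_
    push_cast
    exact add_left_cancel h1
  · rw [shift_vec2_one] at h
    have h1 := (vec2_eq_iff.mp h).2
    rw [add_assoc, add_assoc] at h1
    refine natCast_zmod_ne_of_lt (L := L) (j := b' + 1) (k := T + 1) (by omega) (by omega) (by omega) ?_
    push_cast
    exact add_left_cancel h1

omit [NeZero L] [TopologicalSpace G] [IsTopologicalGroup G] [CompactSpace G] [SecondCountableTopology G]
  [MeasurableSpace G] [BorelSpace G] in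
/-- A plaquette of the rectangle with corner `(i, y + 1)` and height `T` (`T + 2 ≤ L`) ignores the
horizontal links of the row `y`. -/
theorem plaquetteHolonomy_update_bottomrow_of_mem_rect {U : GaugeConfig 2 L G} (i y : ZMod L) {R T : ℕ}
    (hT : T + 2 ≤ L) {p : Site 2 L}
    (hp : p ∈ (range R ×ˢ range T).image (fun q : ℕ × ℕ => (![i + q.1, y + 1 + q.2] : Site 2 L)))
    (x' : ZMod L) (g : G) :
    plaquetteHolonomy (update U (![x', y], 0) g) p 0 1 = plaquetteHolonomy U p 0 1 := by
  obtain ⟨⟨a', b'⟩, hq, rfl⟩ := Finset.mem_image.mp hp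
  rw [Finset.mem_product, Finset.mem_range, Finset.mem_range] at hq
  refine plaquetteHolonomy_update_horiz g (fun h => ?_) (fun h => ?_)
  · have h1 := (vec2_eq_iff.mp h).2
    rw [add_assoc] at h1
    have h2 : (1 : ZMod L) + (b' : ZMod L) = 0 := left_eq_add.mp h1.symm
    refine natCast_zmod_ne_of_lt (L := L) (j := b' + 1) (k := 0) (by omega) (by omega) (by omega) ?_
    push_cast
    linear_combination h2
  · rw [shift_vec2_one] at h
    have h1 := (vec2_eq_iff.mp h).2
    rw [add_assoc, add_assoc] at h1
    have h2 : (1 : ZMod L) + ((b' : ZMod L) + 1) = 0 := left_eq_add.mp h1.symm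
    refine natCast_zmod_ne_of_lt (L := L) (j := b' + 2) (k := 0) (by omega) (by omega) (by omega) ?_
    push_cast
    linear_combination h2

omit [NeZero L] [Group G] [TopologicalSpace G] [IsTopologicalGroup G] [CompactSpace G]
  [SecondCountableTopology G] [MeasurableSpace G] [BorelSpace G] in
/-- Splitting off the FIRST column of a product over the `(R+1) × T` rectangle. -/
theorem prod_rect_succ_left {M' : Type*} [CommMonoid M'] (i j : ZMod L) {R T : ℕ} (hR : R + 1 ≤ L)
    (hT : T ≤ L) (f : Site 2 L → M') :
    ∏ x ∈ (range (R + 1) ×ˢ range T).image (fun q : ℕ × ℕ => (![i + q.1, j + q.2] : Site 2 L)), f x =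
      (∏ b ∈ range T, f ![i, j + b]) *
        ∏ x ∈ (range R ×ˢ range T).image (fun q : ℕ × ℕ => (![i + 1 + q.1, j + q.2] : Site 2 L)), f x := by
  rw [prod_rect_eq i j hR hT, prod_rect_eq (i + 1) j (by omega) hT]
  simp_rw [Finset.prod_range_succ']
  rw [Finset.prod_mul_distrib, mul_comm]
  congr 1
  · simp
  · refine Finset.prod_congr rfl fun b _ => Finset.prod_congr rfl fun a _ => ?_
    rw [show (i : ZMod L) + ((a + 1 : ℕ) : ZMod L) = i + 1 + (a : ZMod L) by push_cast; ring]

omit [NeZero L] [Group G] [TopologicalSpace G] [IsTopologicalGroup G] [CompactSpace G]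
  [SecondCountableTopology G] [MeasurableSpace G] [BorelSpace G] in
/-- Splitting off the TOP row of a product over the `R × (T+1)` rectangle. -/
theorem prod_rect_succ_top {M' : Type*} [CommMonoid M'] (i j : ZMod L) {R T : ℕ} (hR : R ≤ L)
    (hT : T + 1 ≤ L) (f : Site 2 L → M') :
    ∏ x ∈ (range R ×ˢ range (T + 1)).image (fun q : ℕ × ℕ => (![i + q.1, j + q.2] : Site 2 L)), f x =
      (∏ a ∈ range R, f ![i + a, j + T]) *
        ∏ x ∈ (range R ×ˢ range T).image (fun q : ℕ × ℕ => (![i + q.1, j + q.2] : Site 2 L)), f x := by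
  rw [prod_rect_eq i j hR hT, prod_rect_eq i j hR (by omega), Finset.prod_range_succ, mul_comm]

omit [NeZero L] [Group G] [TopologicalSpace G] [IsTopologicalGroup G] [CompactSpace G]
  [SecondCountableTopology G] [MeasurableSpace G] [BorelSpace G] in
/-- Splitting off the BOTTOM row of a product over the `R × (T+1)` rectangle. -/
theorem prod_rect_succ_bottom {M' : Type*} [CommMonoid M'] (i j : ZMod L) {R T : ℕ} (hR : R ≤ L)
    (hT : T + 1 ≤ L) (f : Site 2 L → M') :
    ∏ x ∈ (range R ×ˢ range (T + 1)).image (fun q : ℕ × ℕ => (![i + q.1, j + q.2] : Site 2 L)), f x =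
      (∏ a ∈ range R, f ![i + a, j]) *
        ∏ x ∈ (range R ×ˢ range T).image (fun q : ℕ × ℕ => (![i + q.1, j + 1 + q.2] : Site 2 L)), f x := by
  rw [prod_rect_eq i j hR hT, prod_rect_eq i (j + 1) hR (by omega), Finset.prod_range_succ', mul_comm]
  congr 1
  · simp
  · refine Finset.prod_congr rfl fun b _ => Finset.prod_congr rfl fun a _ => ?_
    rw [show (j : ZMod L) + ((b + 1 : ℕ) : ZMod L) = j + 1 + (b : ZMod L) by push_cast; ring]

end Bookkeeping


end Summit.Ventures.LatticeQCDFlow.Scoring
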